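import Mathlib
import Literature.RingTheory.TwoVariableSeries.Basic
import Summits.ResolutionOfSingularities.ResolutionOfSingularities.Theorems.WeightedInvariantLocalWeightedDropMonicDescentSliceIdentify

/-!
# `WeightedInvariant.LocalWeightedDrop`, sub-stub N4″: the point-move slice at `c = (0, c₁)` is the `u₂`-chart label (piece T-6′, part B″)

Crux item stmt-ResolutionOfSingularities-8899 `LocalWeightedDrop` (route `ResolutionOfSingularities/WeightedInvariant`), door
`WeightedConstruction` stmt-ResolutionOfSingularities-0571.  [OURS · L1 W4.3, chain w43, lead prover; part B″ of piece T-6′ (`monicDescentBridge`) of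
`N4PRIME-PLAN.md` §11.]

* `coeff_subst_blowTwoFamily`, `X_pow_mul_blowTwo` — the `u₂`-chart as a substitution: `u₂^c · blowTwo c A = A(u₁u₂, u₂)`;
* `subst_pointSliceFamily_one_zero` — for `c₀ = 0`, `c₁ ≠ 0`: `B(s y, c₁ s) = c₁^m s^m · (blowTwo m B)(y/c₁, c₁ s)`;
* `represents_pos_swapScale` — representation by the swapped scaling `θ = (c⁻¹ y, c s, c z)`;
* `represents_slice_one_zero` — the game's slice germ at `c = (0, c₁)` (presentation `i₀ = 1`) REPRESENTS `blowTwoLabel B`.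
-/

set_option linter.dupNamespace false -- mandated namespace of this single-conjunct summit

noncomputable section

namespace Summit.ResolutionOfSingularities.ResolutionOfSingularities.Theorems

namespace MonicDescent

open MvPowerSeries Literature.RingTheory.TwoVariableSeries Literature.AlgebraicGeometry.Resolution

variable {k : Type} [Field k]

/-- The `u₂`-chart family `(u₁u₂, u₂)` has zero constant terms. -/
theorem constantCoeff_blowTwoFamily : ∀ i, constantCoeff (![X 0 * X 1, X 1] i : MvPowerSeries (Fin 2) k) = 0 := by
  intro i
  fin_cases i
  · show constantCoeff (X 0 * X 1) = 0
    rw [map_mul, constantCoeff_X, zero_mul]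
  · exact constantCoeff_X 1

/-- COEFFICIENTS OF `A(u₁u₂, u₂)`: the monomial `u^e` goes to `u₁^{e₀} u₂^{e₀+e₁}`. -/
theorem coeff_subst_blowTwoFamily (A : MvPowerSeries (Fin 2) k) (d : Fin 2 →₀ ℕ) :
    coeff d (subst ![X 0 * X 1, X 1] A) =
      if d 0 ≤ d 1 then coeff (Finsupp.single 0 (d 0) + Finsupp.single 1 (d 1 - d 0)) A else 0 := by
  classical
  have hs : HasSubst ![(X 0 * X 1 : MvPowerSeries (Fin 2) k), X 1] := hasSubst_of_constantCoeff_zero constantCoeff_blowTwoFamily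
  rw [coeff_subst hs]
  have hprod : ∀ e : Fin 2 →₀ ℕ, (e.prod fun s m => (![(X 0 * X 1 : MvPowerSeries (Fin 2) k), X 1] s) ^ m) =
      monomial (Finsupp.single 0 (e 0) + Finsupp.single 1 (e 0 + e 1)) 1 := by
    intro e
    rw [Finsupp.prod_fintype _ _ (fun i => pow_zero _), Fin.prod_univ_two]
    show (X 0 * X 1) ^ e 0 * X 1 ^ e 1 = _
    rw [mul_pow, mul_assoc, ← pow_add, X_pow_eq, X_pow_eq, monomial_mul_monomial, one_mul]
  simp_rw [hprod, coeff_monomial]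
  by_cases hd : d 0 ≤ d 1
  · rw [if_pos hd]
    rw [finsum_eq_single _ (Finsupp.single 0 (d 0) + Finsupp.single 1 (d 1 - d 0))]
    · rw [if_pos, smul_eq_mul, mul_one]
      refine finsupp_fin2_ext ?_ ?_
      · simp only [Finsupp.add_apply, Finsupp.single_apply]; simp
      · simp only [Finsupp.add_apply, Finsupp.single_apply]; simp; omega
    · intro e hne
      rw [if_neg, smul_zero]
      intro hde
      apply hne
      have h0 := congrArg (fun P => P 0) hde
      have h1 := congrArg (fun P => P 1) hde
      simp only [Finsupp.add_apply, Finsupp.single_apply] at h0 h1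
      simp at h0 h1
      refine finsupp_fin2_ext ?_ ?_
      · simp only [Finsupp.add_apply, Finsupp.single_apply]; simp; omega
      · simp only [Finsupp.add_apply, Finsupp.single_apply]; simp; omega
  · rw [if_neg hd]
    apply finsum_eq_zero_of_forall_eq_zero
    intro e
    rw [if_neg, smul_zero]
    intro hde
    apply hd
    have h0 := congrArg (fun P => P 0) hde
    have h1 := congrArg (fun P => P 1) hde
    simp only [Finsupp.add_apply, Finsupp.single_apply] at h0 h1
    simp at h0 h1
    omega

/-- `u₂^c · blowTwo c A = A(u₁u₂, u₂)` when every exponent of `A` has `e₀ + e₁ ≥ c`. -/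
theorem X_pow_mul_blowTwo (c : ℕ) (A : MvPowerSeries (Fin 2) k) (hA : ∀ e : Fin 2 →₀ ℕ, coeff e A ≠ 0 → c ≤ e 0 + e 1) :
    X 1 ^ c * blowTwo c A = subst ![X 0 * X 1, X 1] A := by
  ext d
  rw [coeff_subst_blowTwoFamily, X_pow_eq, coeff_monomial_mul]
  by_cases hc : Finsupp.single 1 c ≤ d
  · rw [if_pos hc, one_mul, coeff_blowTwo]
    have hd1 : c ≤ d 1 := by simpa using hc 1
    have hsub0 : (d - Finsupp.single 1 c : Fin 2 →₀ ℕ) 0 = d 0 := by simp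
    have hsub1 : (d - Finsupp.single 1 c : Fin 2 →₀ ℕ) 1 = d 1 - c := by simp
    rw [hsub0, hsub1]
    by_cases hd : d 0 ≤ d 1
    · rw [if_pos hd]
      by_cases hd' : d 0 ≤ d 1 - c + c
      · rw [if_pos hd']
        have hidx : Finsupp.single 0 (d 0) + Finsupp.single 1 (d 1 - c + c - d 0) =
            (Finsupp.single 0 (d 0) + Finsupp.single 1 (d 1 - d 0) : Fin 2 →₀ ℕ) := by
          refine finsupp_fin2_ext ?_ ?_
          · simp only [Finsupp.add_apply, Finsupp.single_apply]; simp
          · simp only [Finsupp.add_apply, Finsupp.single_apply]; simp; omega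
        rw [hidx]
      · exfalso; omega
    · rw [if_neg hd, if_neg (by omega)]
  · rw [if_neg hc]
    have hd1 : d 1 < c := by
      by_contra hge
      push Not at hge
      exact hc (by intro i; fin_cases i <;> simp [hge])
    split_ifs with hd
    · symm
      by_contra hne
      have := hA _ hne
      simp only [Finsupp.add_apply, Finsupp.single_apply] at this
      simp at this
      omega
    · rfl

/-- THE SLICE `i₀ = 1` AT `c = (0, c₁)` AS A CHART: `B(s y, c₁ s) = c₁^m s^m · (blowTwo m B)(y/c₁, c₁ s)`. -/
theorem subst_pointSliceFamily_one_zero (c : Fin 2 → k) (hc0 : c 0 = 0) (hc : c 1 ≠ 0) (B : MvPowerSeries (Fin 2) k) (m : ℕ)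
    (hB : ∀ e : Fin 2 →₀ ℕ, coeff e B ≠ 0 → m ≤ e 0 + e 1) :
    subst (pointSliceFamily 1 c) B =
      C (c 1 ^ m) * X 0 ^ m * subst ![C (c 1)⁻¹ * X 1, C (c 1) * X 0] (blowTwo m B) := by
  set τ : Fin 2 → MvPowerSeries (Fin 2) k := ![C (c 1)⁻¹ * X 1, C (c 1) * X 0] with hτdef
  have hτ : HasSubst τ := hasSubst_of_constantCoeff_zero fun i => by fin_cases i <;> simp [hτdef, constantCoeff_X]
  have hσ : HasSubst ![(X 0 * X 1 : MvPowerSeries (Fin 2) k), X 1] := hasSubst_of_constantCoeff_zero constantCoeff_blowTwoFamily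
  have hrhs : subst τ (X 1 ^ m * blowTwo m B) = C (c 1 ^ m) * X 0 ^ m * subst τ (blowTwo m B) := by
    rw [← coe_substAlgHom hτ, map_mul, map_pow, coe_substAlgHom, subst_X hτ]
    simp only [hτdef, Matrix.cons_val_one, Matrix.cons_val_zero]
    rw [mul_pow, ← map_pow]
  have hF : (fun j : Fin 2 => subst τ ((![(X 0 * X 1 : MvPowerSeries (Fin 2) k), X 1]) j)) = pointSliceFamily 1 c := by
    funext j
    fin_cases j
    · show subst τ (X 0 * X 1) = X 0 * (C (c 0) + if (0 : Fin 2) = 1 then 0 else X 1)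
      rw [← coe_substAlgHom hτ, map_mul, coe_substAlgHom, subst_X hτ, subst_X hτ, if_neg (by decide), hc0, map_zero, zero_add]
      simp only [hτdef, Matrix.cons_val_zero, Matrix.cons_val_one]
      have h1 : (C (c 1)⁻¹ : MvPowerSeries (Fin 2) k) * C (c 1) = 1 := by rw [← map_mul, inv_mul_cancel₀ hc, map_one]
      linear_combination (X 1 * X 0) * h1
    · show subst τ (X 1) = X 0 * (C (c 1) + if (1 : Fin 2) = 1 then 0 else X 1)
      rw [subst_X hτ, if_pos rfl, add_zero]
      simp only [hτdef, Matrix.cons_val_one, Matrix.cons_val_zero]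
      ring
  rw [← hrhs, X_pow_mul_blowTwo m _ hB, subst_comp_subst_apply hσ hτ, hF]

/-- The swapped scaling `(c⁻¹ y, c s, c z)` of the three game variables. -/
def swapScale3 (c : k) : Fin 3 → MvPowerSeries (Fin 3) k := ![C c⁻¹ * X 1, C c * X 0, C c * X 2]

/-- `swapScale3` has zero constant terms. -/
theorem constantCoeff_swapScale3 (c : k) : ∀ i, constantCoeff (swapScale3 c i) = 0 := by
  intro i; fin_cases i <;> simp [swapScale3, constantCoeff_X]

/-- The linear part of `swapScale3`. -/
theorem linMat_swapScale3 (c : k) :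
    FormalCoordChange.linMat (swapScale3 c) = Matrix.of ![![0, c⁻¹, 0], ![c, 0, 0], ![0, 0, c]] := by
  ext i j
  rw [FormalCoordChange.linMat, Matrix.of_apply, Matrix.of_apply]
  fin_cases i <;> fin_cases j <;> simp [swapScale3, coeff_index_single_X]

/-- REPRESENTATION BY THE SWAPPED SCALING: `pos (c²·L₀(y/c, c s)) (c·L₁(y/c, c s))` represents `(L₀, L₁)`. -/
theorem represents_pos_swapScale (L₀ L₁ : MvPowerSeries (Fin 2) k) {c : k} (hc : c ≠ 0)
    {A₀ A₁ : MvPowerSeries (Fin 2) k} (h₀ : A₀ = C (c ^ 2) * subst ![C c⁻¹ * X 1, C c * X 0] L₀)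
    (h₁ : A₁ = C c * subst ![C c⁻¹ * X 1, C c * X 0] L₁) :
    Represents (pos A₀ A₁) L₀ L₁ := by
  have h3 := constantCoeff_swapScale3 c
  have h3s : HasSubst (swapScale3 c) := hasSubst_of_constantCoeff_zero h3
  have hτ : HasSubst (![C c⁻¹ * X 1, C c * X 0] : Fin 2 → MvPowerSeries (Fin 2) k) :=
    hasSubst_of_constantCoeff_zero fun i => by fin_cases i <;> simp [constantCoeff_X]
  have hcomp : HasSubst (fun i : Fin 2 => swapScale3 c (Fin.succAboveEmb (Fin.last 2) i)) :=
    hasSubst_of_constantCoeff_zero fun i => h3 _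
  have hundo : ∀ L : MvPowerSeries (Fin 2) k,
      subst (swapScale3 c) (rename (Fin.succAboveEmb (Fin.last 2)) (subst ![C c⁻¹ * X 1, C c * X 0] L)) =
        rename (Fin.succAboveEmb (Fin.last 2)) L := by
    intro L
    rw [subst_rename_eq _ _ h3, subst_comp_subst_apply hτ hcomp, rename_eq_subst]
    congr 1
    funext i
    have h0 : (Fin.succAboveEmb (Fin.last 2)) (0 : Fin 2) = (0 : Fin 3) := rfl
    have h1 : (Fin.succAboveEmb (Fin.last 2)) (1 : Fin 2) = (1 : Fin 3) := rfl
    fin_cases i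
    · show subst _ (C c⁻¹ * X 1) = X ((Fin.succAboveEmb (Fin.last 2)) 0)
      rw [← smul_eq_C_mul, subst_smul hcomp, subst_X hcomp, h0]
      show c⁻¹ • swapScale3 c ((Fin.succAboveEmb (Fin.last 2)) 1) = X 0
      rw [h1]
      simp only [swapScale3, Matrix.cons_val_one, Matrix.cons_val_zero]
      rw [smul_eq_C_mul, ← mul_assoc, ← map_mul, inv_mul_cancel₀ hc, map_one, one_mul]
    · show subst _ (C c * X 0) = X ((Fin.succAboveEmb (Fin.last 2)) 1)
      rw [← smul_eq_C_mul, subst_smul hcomp, subst_X hcomp, h1]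
      show c • swapScale3 c ((Fin.succAboveEmb (Fin.last 2)) 0) = X 1
      rw [h0]
      simp only [swapScale3, Matrix.cons_val_zero]
      rw [smul_eq_C_mul, ← mul_assoc, ← map_mul, mul_inv_cancel₀ hc, map_one, one_mul]
  refine ⟨swapScale3 c, C (c ^ 2), h3, ?_, ?_, ?_⟩
  · rw [linMat_swapScale3, Matrix.det_fin_three]
    refine isUnit_iff_ne_zero.mpr ?_
    simp [hc]
  · rw [constantCoeff_C]; exact pow_ne_zero 2 hc
  · unfold pos
    have hz : swapScale3 c (Fin.last 2) = C c * X (Fin.last 2) := rfl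
    rw [h₀, h₁, map_mul, map_mul, rename_C, rename_C, ← coe_substAlgHom h3s]
    simp only [map_add, map_mul, map_pow]
    rw [coe_substAlgHom, subst_C, subst_X h3s, hz, hundo L₀, hundo L₁]
    show _ = _ * (X (Fin.last 2) ^ 2 + (rename (Fin.succAboveEmb (Fin.last 2)) L₀ +
      rename (Fin.succAboveEmb (Fin.last 2)) L₁ * X (Fin.last 2)))
    ring

/-- THE SLICE GERM at `c = (0, c₁)` (presentation `i₀ = 1`) REPRESENTS `blowTwoLabel B`. -/
theorem represents_slice_one_zero (c : Fin 2 → k) (hc0 : c 0 = 0) (hc : c 1 ≠ 0) (B : Label k) (hpos : IsPosition B.1 B.2)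
    (Bv : Fin 2 → MvPowerSeries (Fin 3) k)
    (hBv : ∀ j : Fin 2, subst (CobordantChart.chart (fun _ : Fin 2 => 1) c)
      ((![B.1, B.2] : Fin 2 → MvPowerSeries (Fin 2) k) j) = X 0 ^ (2 - (j : ℕ) + 1) * Bv j) :
    Represents (pos (TupleGame.slice 1 (X 0 * Bv 0)) (TupleGame.slice 1 (X 0 * Bv 1)))
      (blowTwoLabel B).1 (blowTwoLabel B).2 := by
  have h2 : ∀ e : Fin 2 →₀ ℕ, coeff e B.1 ≠ 0 → 2 ≤ e 0 + e 1 := le_sum_of_le_order (c := 2) hpos.1.le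
  have h1 : ∀ e : Fin 2 →₀ ℕ, coeff e B.2 ≠ 0 → 1 ≤ e 0 + e 1 := le_sum_of_le_order (c := 1) hpos.2.le
  have hA0 : TupleGame.slice 1 (X 0 * Bv 0) = C (c 1 ^ 2) * subst ![C (c 1)⁻¹ * X 1, C (c 1) * X 0] (blowTwo 2 B.1) := by
    apply X_pow_mul_left_cancel (c := 2)
    have := sliceLabel_spec 1 c (j := 0) (hBv 0)
    simp only [Nat.sub_zero] at this
    rw [this]
    show subst (pointSliceFamily 1 c) B.1 = _
    rw [subst_pointSliceFamily_one_zero c hc0 hc B.1 2 h2]; ring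
  have hA1 : TupleGame.slice 1 (X 0 * Bv 1) = C (c 1) * subst ![C (c 1)⁻¹ * X 1, C (c 1) * X 0] (blowTwo 1 B.2) := by
    apply X_pow_mul_left_cancel (c := 1)
    have := sliceLabel_spec 1 c (j := 1) (hBv 1)
    simp only [show 2 - 1 = 1 from rfl] at this
    rw [this]
    show subst (pointSliceFamily 1 c) B.2 = _
    rw [subst_pointSliceFamily_one_zero c hc0 hc B.2 1 h1, pow_one, pow_one]; ring
  exact represents_pos_swapScale _ _ hc hA0 hA1

end MonicDescent

end Summit.ResolutionOfSingularities.ResolutionOfSingularities.Theorems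

end
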